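import Literature.NumberTheory.LFunctions.NymanBeurlingVectors
import Mathlib.MeasureTheory.Integral.ExpDecay
import Mathlib.Analysis.SpecialFunctions.Integrals.Basic
import HarnessLib

/-!
# Asymptotics of Burnol's vectors: the pairing with `χ` and the norms

Continuation of `Literature/NumberTheory/LFunctions/NymanBeurlingVectors.lean` (Burnol 2002,
§5, Theorems 5.2–5.3 for the `k = 0` vectors, on the Mellin side). With `s = 1/2 + iτ`,
`ρ = 1/2 + iγ` a zero of `ζ`, `0 < λ < 1`, `L = log(1/λ)` and `k = k₁ + k₂` as in that file:

* `∫ k₁(s)/s dτ = 2π ∫_λ^1 t^{ρ-1} p(-log t) dt`, `p(x) = x³/6 - x⁴/24`, which tends to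
  `2π 𝓜[𝟙_{(0,1]} p(-log ·)](ρ) = 2π (ρ - 1)/ρ⁵` as `λ → 0⁺` (Parseval with the truncated power
  `𝟙_{(λ,1]} t^{-ρ}` and Mellin inversion for `𝟙_{(0,1]} p(-log t)`);
* `∫ k₂(s)/s dτ → 0` (Riemann–Lebesgue);
* `∫ |1 - λ^{s-ρ}|²/|s-ρ|² dτ = 2π L` (Mellin–Plancherel for `𝟙_{(λ,1]} t^{-ρ}`), whence
  `‖k₁‖² ≤ 2πL/|ρ|⁶ + O(1 + log L)`, `‖k₂‖ = O(1)`, and cross terms `∫ |k_{ρ}| |k_{ρ'}| = O(1 + log L)`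
  for `ρ ≠ ρ'`.

## References

* J.-F. Burnol, *A lower bound in an approximation problem involving the zeros of the Riemann
  zeta function*, Adv. Math. 170 (2002), 56–70; arXiv:math/0103058, Thms. 5.2, 5.3.
-/

noncomputable section

open Complex Filter MeasureTheory Set Asymptotics
open scoped Real Topology ComplexConjugate FourierTransform

namespace Literature.NumberTheory.LFunctions

namespace BurnolVectors

/-! ## The Laplace integral `∫_0^∞ p(x) e^{-sx} dx = (s-1)/s⁵`, `p(x) = x³/6 - x⁴/24` -/

/-- `p(x) = x³/6 - x⁴/24` (so that `∫_0^∞ p(x)e^{-sx}dx = 1/s⁴ - 1/s⁵ = r(s)/s`). [folklore] -/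
def pPolyC (z : ℂ) : ℂ :=
  z ^ 3 / 6 - z ^ 4 / 24

/-- The polynomial `P_s` with `d/dx (-e^{-sx} P_s(x)) = p(x) e^{-sx}`. [folklore] -/
def primPC (s z : ℂ) : ℂ :=
  -(z ^ 4 / (24 * s)) + (s - 1) * z ^ 3 / (6 * s ^ 2) + (s - 1) * z ^ 2 / (2 * s ^ 3) +
    (s - 1) * z / s ^ 4 + (s - 1) / s ^ 5

/-- The primitive `F_s(z) = -e^{-sz} P_s(z)`. [folklore] -/
def primFC (s z : ℂ) : ℂ :=
  -Complex.exp (-(s * z)) * primPC s z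

/-- `F_s' = p · e^{-s·}` (as functions on `ℂ`). [folklore] -/
theorem hasDerivAt_primFC {s : ℂ} (hs : s ≠ 0) (z : ℂ) :
    HasDerivAt (primFC s) (pPolyC z * Complex.exp (-(s * z))) z := by
  have hP : HasDerivAt (primPC s)
      (-(4 * z ^ 3 / (24 * s)) + (s - 1) * (3 * z ^ 2) / (6 * s ^ 2) +
        (s - 1) * (2 * z) / (2 * s ^ 3) + (s - 1) * 1 / s ^ 4) z := by
    have h4 := ((hasDerivAt_pow 4 z).div_const (24 * s)).neg
    have h3 := ((hasDerivAt_pow 3 z).const_mul (s - 1)).div_const (6 * s ^ 2)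
    have h2 := ((hasDerivAt_pow 2 z).const_mul (s - 1)).div_const (2 * s ^ 3)
    have h1 := ((hasDerivAt_id' z).const_mul (s - 1)).div_const (s ^ 4)
    have h0 := hasDerivAt_const z ((s - 1) / s ^ 5)
    have := (((h4.add h3).add h2).add h1).add h0
    refine (this.congr_deriv ?_).congr_of_eventuallyEq (Eventually.of_forall fun w ↦ ?_)
    · push_cast; ring
    · simp only [Pi.add_apply, Pi.neg_apply, primPC]
  have hE : HasDerivAt (fun w : ℂ ↦ Complex.exp (-(s * w))) (Complex.exp (-(s * z)) * (-(s * 1))) z :=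
    ((hasDerivAt_id' z).const_mul s).neg.cexp
  have := hE.neg.mul hP
  refine (this.congr_deriv ?_).congr_of_eventuallyEq (Eventually.of_forall fun w ↦ ?_)
  · simp only [Pi.neg_apply, pPolyC, primPC]
    field_simp
    ring
  · simp only [Pi.mul_apply, Pi.neg_apply, primFC]

/-- `e^{-sx} x^k → 0` as `x → +∞` for `re s > 0`. [folklore] -/
theorem tendsto_cexp_neg_mul_pow {s : ℂ} (hs : 0 < s.re) (k : ℕ) :
    Tendsto (fun x : ℝ ↦ Complex.exp (-(s * x)) * (x : ℂ) ^ k) atTop (𝓝 0) := by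
  rw [tendsto_zero_iff_norm_tendsto_zero]
  have h1 : Tendsto (fun x : ℝ ↦ (s.re * x) ^ k * Real.exp (-(s.re * x))) atTop (𝓝 0) :=
    (Real.tendsto_pow_mul_exp_neg_atTop_nhds_zero k).comp (tendsto_id.const_mul_atTop hs)
  have h2 := h1.const_mul ((s.re ^ k)⁻¹)
  rw [mul_zero] at h2
  refine h2.congr' ?_
  filter_upwards [eventually_ge_atTop 0] with x hx
  rw [norm_mul, Complex.norm_exp, norm_pow, Complex.norm_real, Real.norm_eq_abs, abs_of_nonneg hx]
  have : (-(s * (x : ℂ))).re = -(s.re * x) := by simp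
  rw [this, mul_pow]
  have hsk : s.re ^ k ≠ 0 := pow_ne_zero _ hs.ne'
  field_simp

/-- `e^{-sx} P_s(x) → 0` as `x → +∞` for `re s > 0`. [folklore] -/
theorem tendsto_cexp_neg_mul_primPC {s : ℂ} (hs : 0 < s.re) :
    Tendsto (fun x : ℝ ↦ Complex.exp (-(s * x)) * primPC s x) atTop (𝓝 0) := by
  have h := fun k ↦ tendsto_cexp_neg_mul_pow hs k
  have : (fun x : ℝ ↦ Complex.exp (-(s * x)) * primPC s x) = fun x : ℝ ↦
      (-(1 / (24 * s))) * (Complex.exp (-(s * x)) * (x : ℂ) ^ 4) +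
      ((s - 1) / (6 * s ^ 2)) * (Complex.exp (-(s * x)) * (x : ℂ) ^ 3) +
      ((s - 1) / (2 * s ^ 3)) * (Complex.exp (-(s * x)) * (x : ℂ) ^ 2) +
      ((s - 1) / s ^ 4) * (Complex.exp (-(s * x)) * (x : ℂ) ^ 1) +
      ((s - 1) / s ^ 5) * (Complex.exp (-(s * x)) * (x : ℂ) ^ 0) := by
    funext x; simp only [primPC]; ring
  rw [this]
  have e : (0 : ℂ) = (-(1 / (24 * s))) * 0 + ((s - 1) / (6 * s ^ 2)) * 0 + ((s - 1) / (2 * s ^ 3)) * 0 +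
      ((s - 1) / s ^ 4) * 0 + ((s - 1) / s ^ 5) * 0 := by ring
  rw [e]
  exact ((((h 4).const_mul _).add ((h 3).const_mul _)).add ((h 2).const_mul _)).add
    ((h 1).const_mul _) |>.add ((h 0).const_mul _)

/-- `e^{-sx} p(x) → 0` as `x → +∞` for `re s > 0`. [folklore] -/
theorem tendsto_cexp_neg_mul_pPolyC {s : ℂ} (hs : 0 < s.re) :
    Tendsto (fun x : ℝ ↦ Complex.exp (-(s * x)) * pPolyC x) atTop (𝓝 0) := by
  have h := fun k ↦ tendsto_cexp_neg_mul_pow hs k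
  have : (fun x : ℝ ↦ Complex.exp (-(s * x)) * pPolyC x) = fun x : ℝ ↦
      (1 / 6 : ℂ) * (Complex.exp (-(s * x)) * (x : ℂ) ^ 3) +
      (-(1 / 24) : ℂ) * (Complex.exp (-(s * x)) * (x : ℂ) ^ 4) := by
    funext x; simp only [pPolyC]; ring
  rw [this]
  have e : (0 : ℂ) = (1 / 6 : ℂ) * 0 + (-(1 / 24) : ℂ) * 0 := by ring
  rw [e]
  exact ((h 3).const_mul _).add ((h 4).const_mul _)

/-- The Laplace integrand `x ↦ p(x)e^{-sx}` is integrable on `(0,∞)` for `re s > 0`. [folklore] -/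
theorem integrableOn_pPolyC_mul_cexp {s : ℂ} (hs : 0 < s.re) :
    IntegrableOn (fun x : ℝ ↦ pPolyC x * Complex.exp (-(s * x))) (Ioi 0) := by
  have hcont : Continuous fun x : ℝ ↦ pPolyC x * Complex.exp (-(s * x)) := by
    unfold pPolyC; fun_prop
  -- the norm is `O(e^{-(σ/2)x})`
  have hs2 : 0 < (s / 2).re := by simp; linarith
  have ht := tendsto_cexp_neg_mul_pPolyC hs2
  rw [tendsto_zero_iff_norm_tendsto_zero] at ht
  have hev : ∀ᶠ x : ℝ in atTop, ‖‖pPolyC x * Complex.exp (-(s * x))‖‖ ≤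
      1 * ‖Real.exp (-(s.re / 2) * x)‖ := by
    filter_upwards [ht.eventually (ge_mem_nhds one_pos), eventually_ge_atTop (0 : ℝ)] with x hx _
    rw [norm_norm, one_mul, Real.norm_eq_abs, abs_of_pos (Real.exp_pos _), norm_mul,
      Complex.norm_exp]
    rw [norm_mul, Complex.norm_exp] at hx
    have e1 : (-(s / 2 * (x : ℂ))).re = -(s.re / 2 * x) := by simp
    have e2 : (-(s * (x : ℂ))).re = -(s.re / 2 * x) + -(s.re / 2 * x) := by simp; ring
    rw [e1] at hx
    rw [e2, Real.exp_add, ← mul_assoc]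
    calc ‖pPolyC x‖ * Real.exp (-(s.re / 2 * x)) * Real.exp (-(s.re / 2 * x))
        ≤ 1 * Real.exp (-(s.re / 2 * x)) := by
          gcongr; rwa [mul_comm] at hx
      _ = Real.exp (-(s.re / 2) * x) := by ring_nf
  have hnorm : IntegrableOn (fun x : ℝ ↦ ‖pPolyC x * Complex.exp (-(s * x))‖) (Ioi 0) :=
    integrable_of_isBigO_exp_neg (b := s.re / 2) (by linarith) hcont.norm.continuousOn
      (IsBigO.of_bound 1 hev)
  exact (integrable_norm_iff hcont.aestronglyMeasurable).1 hnorm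

/-- **The Laplace integral** `∫_0^∞ p(x) e^{-sx} dx = (s-1)/s⁵` for `re s > 0`. [folklore] -/
theorem integral_pPolyC_mul_cexp {s : ℂ} (hs : 0 < s.re) :
    ∫ x in Ioi (0 : ℝ), pPolyC x * Complex.exp (-(s * x)) = (s - 1) / s ^ 5 := by
  have hs0 : s ≠ 0 := fun h ↦ by simp [h] at hs
  have hFTC : ∀ R : ℝ, ∫ x in (0 : ℝ)..R, pPolyC x * Complex.exp (-(s * x)) =
      primFC s (R : ℝ) - primFC s ((0 : ℝ) : ℂ) := by
    intro R
    refine intervalIntegral.integral_eq_sub_of_hasDerivAt (f := fun x : ℝ ↦ primFC s x)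
      (fun x _ ↦ ?_) ?_
    · exact (hasDerivAt_primFC hs0 x).comp_ofReal
    · exact (Continuous.intervalIntegrable (by unfold pPolyC; fun_prop) _ _)
  have h0 : primFC s ((0 : ℝ) : ℂ) = -((s - 1) / s ^ 5) := by
    simp [primFC, primPC]
  have hlim1 : Tendsto (fun R : ℝ ↦ ∫ x in (0 : ℝ)..R, pPolyC x * Complex.exp (-(s * x))) atTop
      (𝓝 (∫ x in Ioi (0 : ℝ), pPolyC x * Complex.exp (-(s * x)))) :=
    intervalIntegral_tendsto_integral_Ioi 0 (integrableOn_pPolyC_mul_cexp hs) tendsto_id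
  have hlim2 : Tendsto (fun R : ℝ ↦ ∫ x in (0 : ℝ)..R, pPolyC x * Complex.exp (-(s * x))) atTop
      (𝓝 (0 - primFC s ((0 : ℝ) : ℂ))) := by
    simp_rw [hFTC]
    refine Tendsto.sub ?_ tendsto_const_nhds
    have := (tendsto_cexp_neg_mul_primPC hs).neg
    rw [neg_zero] at this
    refine this.congr fun R ↦ ?_
    simp [primFC]
  rw [tendsto_nhds_unique hlim1 hlim2, h0]
  ring


/-! ## The test function `f(t) = 𝟙_{(0,1]}(t) p(-log t)` and its Mellin transform `r(s)/s` -/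

/-- `f(t) = 𝟙_{(0,1]}(t) · p(-log t)`, the function on `(0,∞)` with Mellin transform
`𝓜f(s) = (s-1)/s⁵ = r(s)/s`. [folklore] -/
def fLog (t : ℝ) : ℂ :=
  (Ioc (0 : ℝ) 1).indicator (fun t ↦ pPolyC ((-Real.log t : ℝ) : ℂ)) t

/-- `p(0) = 0`. [folklore] -/
lemma pPolyC_zero : pPolyC 0 = 0 := by simp [pPolyC]

/-- For `x` real: `(e^{-x})^{w} = e^{-xw}` as complex powers of the positive real `e^{-x}`.
[folklore] -/
lemma ofReal_exp_neg_cpow (x : ℝ) (w : ℂ) :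
    ((Real.exp (-x) : ℝ) : ℂ) ^ w = Complex.exp (-(x : ℂ) * w) := by
  rw [cpow_def_of_ne_zero (by exact_mod_cast (Real.exp_pos _).ne'), ← ofReal_log (Real.exp_pos _).le,
    Real.log_exp]
  push_cast
  ring_nf

/-- The substitution `t = e^{-x}` turns the Mellin integrand of `f` into the Laplace integrand
`𝟙_{x>0} p(x) e^{-sx}`. [folklore] -/
theorem exp_neg_smul_fLog (s : ℂ) (x : ℝ) :
    Real.exp (-x) • (((Real.exp (-x) : ℝ) : ℂ) ^ (s - 1) • fLog (Real.exp (-x))) =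
      (Ioi (0 : ℝ)).indicator (fun x : ℝ ↦ pPolyC x * Complex.exp (-(s * x))) x := by
  rcases lt_trichotomy x 0 with hx | rfl | hx
  · -- `x < 0`: `e^{-x} > 1`, both sides vanish
    have h1 : Real.exp (-x) ∉ Ioc (0 : ℝ) 1 := fun h ↦ by
      have : (1 : ℝ) < Real.exp (-x) := by rw [← Real.exp_zero]; exact Real.exp_lt_exp.2 (by linarith)
      linarith [h.2]
    rw [fLog, indicator_of_notMem h1, indicator_of_notMem (by simpa using hx.le)]
    simp
  · simp [fLog, pPolyC_zero]
  · have h1 : Real.exp (-x) ∈ Ioc (0 : ℝ) 1 := ⟨Real.exp_pos _, by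
      rw [← Real.exp_zero]; exact Real.exp_le_exp.2 (by linarith)⟩
    rw [fLog, indicator_of_mem h1, indicator_of_mem (show x ∈ Ioi (0 : ℝ) from hx), Real.log_exp,
      neg_neg, ofReal_exp_neg_cpow, Complex.real_smul, smul_eq_mul, Complex.ofReal_exp]
    rw [show pPolyC ((x : ℝ) : ℂ) * Complex.exp (-(s * x)) =
      Complex.exp ((-x : ℝ) : ℂ) * Complex.exp (-(x : ℂ) * (s - 1)) * pPolyC x by
        rw [← Complex.exp_add]; push_cast; ring_nf]
    ring

/-- **`f` has an absolutely convergent Mellin transform on `re s > 0`.** [folklore] -/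
theorem mellinConvergent_fLog {s : ℂ} (hs : 0 < s.re) : MellinConvergent fLog s := by
  rw [MellinConvergent, Literature.Analysis.FunctionSpaces.integrableOn_Ioi_iff_integrable_exp_neg_smul]
  simp_rw [exp_neg_smul_fLog]
  exact (integrableOn_pPolyC_mul_cexp hs).integrable_indicator measurableSet_Ioi

/-- **`𝓜f(s) = (s-1)/s⁵`** for `re s > 0`. [folklore] -/
theorem mellin_fLog {s : ℂ} (hs : 0 < s.re) : mellin fLog s = (s - 1) / s ^ 5 := by
  rw [mellin, Literature.Analysis.FunctionSpaces.integral_Ioi_eq_integral_exp_neg_smul]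
  simp_rw [exp_neg_smul_fLog]
  rw [integral_indicator measurableSet_Ioi, integral_pPolyC_mul_cexp hs]

/-- `𝓜f = r(s)/s` on the critical line. [folklore] -/
theorem mellin_fLog_line (τ : ℝ) :
    mellin fLog ((1 / 2 : ℂ) + τ * I) = burnolR ((1 / 2 : ℂ) + τ * I) / ((1 / 2 : ℂ) + τ * I) := by
  rw [mellin_fLog (by simp), burnolR, div_div, ← pow_succ]

/-- `𝓜f` is integrable along the critical line. [folklore] -/
theorem integrable_mellin_fLog_line :
    Integrable fun τ : ℝ ↦ mellin fLog ((1 / 2 : ℂ) + τ * I) := by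
  have hm : Measurable fun τ : ℝ ↦ mellin fLog ((1 / 2 : ℂ) + τ * I) := by
    simp_rw [mellin_fLog_line]
    exact continuous_burnolR_line.measurable.div (by fun_prop)
  refine (integrable_and_memLp_two_of_norm_le (C := 2 * 8) hm fun τ ↦ ?_).1
  rw [mellin_fLog_line, norm_div]
  have h1 := norm_burnolR_line_le_inv τ
  have h2 := half_le_norm_line τ
  rw [div_le_iff₀ (by linarith)]
  calc ‖burnolR ((1 / 2 : ℂ) + τ * I)‖ ≤ 8 * (1 + τ ^ 2)⁻¹ := h1
    _ = 2 * 8 * (1 + τ ^ 2)⁻¹ * (1 / 2) := by ring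
    _ ≤ 2 * 8 * (1 + τ ^ 2)⁻¹ * ‖(1 / 2 : ℂ) + τ * I‖ := by gcongr

/-- `f` is continuous on `(0,∞)` (at `t = 1` because `p(0) = 0`). [folklore] -/
theorem continuousAt_fLog {t : ℝ} (ht : 0 < t) : ContinuousAt fLog t := by
  have heq : fLog =ᶠ[𝓝 t] fun u ↦ pPolyC ((max (-Real.log u) 0 : ℝ) : ℂ) := by
    filter_upwards [Ioi_mem_nhds ht] with u (hu : 0 < u)
    by_cases hu1 : u ≤ 1
    · rw [fLog, indicator_of_mem (show u ∈ Ioc (0 : ℝ) 1 from ⟨hu, hu1⟩), max_eq_left]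
      have := Real.log_nonpos hu.le hu1
      linarith
    · rw [not_le] at hu1
      rw [fLog, indicator_of_notMem (fun h ↦ absurd h.2 (not_le.2 hu1)), max_eq_right, ofReal_zero,
        pPolyC_zero]
      have := Real.log_pos hu1
      linarith
  refine (ContinuousAt.congr ?_ heq.symm)
  have h1 : ContinuousAt (fun u : ℝ ↦ max (-Real.log u) 0) t :=
    ((Real.continuousAt_log ht.ne').neg).max continuousAt_const
  have h2 : Continuous fun y : ℝ ↦ pPolyC ((y : ℝ) : ℂ) := by unfold pPolyC; fun_prop
  exact h2.continuousAt.comp h1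

/-- **Mellin inversion for `f`**: `𝓜⁻¹(𝓜f) = f` on `(0,∞)` (Mathlib `mellinInv_mellin_eq`).
[folklore] -/
theorem mellinInv_mellin_fLog {t : ℝ} (ht : 0 < t) : mellinInv (1 / 2) (mellin fLog) t = fLog t := by
  refine mellinInv_mellin_eq (1 / 2) fLog ht ?_ ?_ (continuousAt_fLog ht)
  · have := mellinConvergent_fLog (s := ((1 / 2 : ℝ) : ℂ)) (by simp)
    exact this
  · have h := integrable_mellin_fLog_line
    have e : (fun τ : ℝ ↦ mellin fLog ((1 / 2 : ℂ) + τ * I)) =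
        fun τ : ℝ ↦ mellin fLog (((1 / 2 : ℝ) : ℂ) + τ * I) := by
      funext τ; push_cast; ring_nf
    rw [e] at h
    exact h


/-! ## The truncated power `g_λ(t) = 𝟙_{(λ,1]}(t) t^{-ρ}` -/

/-- `g_λ(t) = 𝟙_{(λ,1]}(t) · t^{-ρ}` with `ρ = 1/2 + iγ` (Burnol's truncated `ψ_ρ`): its Mellin
transform is `(1 - λ^{s-ρ})/(s-ρ)` and `‖g_λ‖²_{L²(0,∞)} = log(1/λ)`. [cite: Burnol2002, Thm. 4.2] -/
def gTrunc (γ lam : ℝ) (t : ℝ) : ℂ :=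
  (Ioc lam 1).indicator (fun t : ℝ ↦ (t : ℂ) ^ (-((1 / 2 : ℂ) + γ * I))) t

/-- `g_λ` has an absolutely convergent Mellin transform at every `s` (for `λ > 0`). [folklore] -/
theorem mellinConvergent_gTrunc (γ : ℝ) {lam : ℝ} (hlam : 0 < lam) (s : ℂ) :
    MellinConvergent (gTrunc γ lam) s := by
  rw [MellinConvergent]
  have e : (fun t : ℝ ↦ (t : ℂ) ^ (s - 1) • gTrunc γ lam t) =
      (Ioc lam 1).indicator fun t : ℝ ↦ (t : ℂ) ^ (s - 1) * (t : ℂ) ^ (-((1 / 2 : ℂ) + γ * I)) := by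
    funext t
    by_cases ht : t ∈ Ioc lam 1
    · rw [gTrunc, indicator_of_mem ht, indicator_of_mem ht, smul_eq_mul]
    · rw [gTrunc, indicator_of_notMem ht, indicator_of_notMem ht, smul_zero]
  rw [e, integrableOn_indicator_iff measurableSet_Ioc, IntegrableOn,
    inter_eq_left.2 (Ioc_subset_Ioi_self.trans (Ioi_subset_Ioi hlam.le))]
  have hcont : ContinuousOn (fun t : ℝ ↦ (t : ℂ) ^ (s - 1) * (t : ℂ) ^ (-((1 / 2 : ℂ) + γ * I)))
      (Icc lam 1) := by
    intro t ht
    have ht0 : t ≠ 0 := by linarith [ht.1]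
    exact ((continuousAt_ofReal_cpow_const t _ (Or.inr ht0)).mul
      (continuousAt_ofReal_cpow_const t _ (Or.inr ht0))).continuousWithinAt
  exact (hcont.integrableOn_Icc).mono_set Ioc_subset_Icc_self

/-- **`𝓜g_λ(s) = (1 - λ^{s-ρ})/(s-ρ)`** for `s ≠ ρ`, `0 < λ ≤ 1`. [cite: Burnol2002, Thm. 4.2] -/
theorem mellin_gTrunc (γ : ℝ) {lam : ℝ} (hlam : 0 < lam) (hlam1 : lam ≤ 1) {s : ℂ}
    (hs : s ≠ (1 / 2 : ℂ) + γ * I) :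
    mellin (gTrunc γ lam) s =
      (1 - (lam : ℂ) ^ (s - ((1 / 2 : ℂ) + γ * I))) / (s - ((1 / 2 : ℂ) + γ * I)) := by
  set ρ : ℂ := (1 / 2 : ℂ) + γ * I with hρ
  have e : ∀ t ∈ Ioi (0 : ℝ), (t : ℂ) ^ (s - 1) • gTrunc γ lam t =
      (Ioc lam 1).indicator (fun t : ℝ ↦ (t : ℂ) ^ (s - 1 - ρ)) t := by
    intro t ht
    have ht0 : (t : ℂ) ≠ 0 := by exact_mod_cast (ne_of_gt ht)
    by_cases htm : t ∈ Ioc lam 1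
    · rw [gTrunc, indicator_of_mem htm, indicator_of_mem htm, smul_eq_mul, ← cpow_add _ _ ht0]
      congr 1
    · rw [gTrunc, indicator_of_notMem htm, indicator_of_notMem htm, smul_zero]
  rw [mellin, setIntegral_congr_fun measurableSet_Ioi e, setIntegral_indicator measurableSet_Ioc,
    inter_eq_right.2 (Ioc_subset_Ioi_self.trans (Ioi_subset_Ioi hlam.le)),
    ← intervalIntegral.integral_of_le hlam1, integral_cpow]
  · rw [show s - 1 - ρ + 1 = s - ρ by ring, ofReal_one, one_cpow]
  · refine Or.inr ⟨fun h ↦ hs ?_, ?_⟩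
    · have := congrArg (· + 1) h; simp at this
      rw [hρ]; linear_combination this
    · rw [uIcc_of_le hlam1]; exact fun h ↦ by linarith [h.1]

/-- **`‖g_λ‖² = log(1/λ)`**: `∫_0^∞ ‖g_λ(t)‖² dt = -log λ` for `0 < λ ≤ 1`. [cite: Burnol2002, Thm. 5.2 (proof)] -/
theorem integral_norm_sq_gTrunc (γ : ℝ) {lam : ℝ} (hlam : 0 < lam) (hlam1 : lam ≤ 1) :
    IntegrableOn (fun t : ℝ ↦ ‖gTrunc γ lam t‖ ^ 2) (Ioi 0) ∧
      ∫ t in Ioi (0 : ℝ), ‖gTrunc γ lam t‖ ^ 2 = -Real.log lam := by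
  have e : ∀ t ∈ Ioi (0 : ℝ), ‖gTrunc γ lam t‖ ^ 2 = (Ioc lam 1).indicator (fun t : ℝ ↦ t⁻¹) t := by
    intro t ht
    by_cases htm : t ∈ Ioc lam 1
    · rw [gTrunc, indicator_of_mem htm, indicator_of_mem htm, norm_cpow_eq_rpow_re_of_pos ht]
      simp only [neg_re, add_re, one_div, inv_re, re_ofNat, normSq_ofNat, mul_re, ofReal_re, I_re,
        mul_zero, ofReal_im, I_im, mul_one, sub_self, add_zero]
      rw [← Real.rpow_natCast, ← Real.rpow_mul ht.le]
      norm_num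
      rw [Real.rpow_neg_one]
    · rw [gTrunc, indicator_of_notMem htm, indicator_of_notMem htm, norm_zero]
      norm_num
  have hint : IntegrableOn (fun t : ℝ ↦ t⁻¹) (Ioc lam 1) := by
    refine ((continuousOn_inv₀.mono ?_).integrableOn_Icc).mono_set Ioc_subset_Icc_self
    intro t ht; exact ne_of_gt (hlam.trans_le ht.1)
  have h' : IntegrableOn ((Ioc lam 1).indicator fun t : ℝ ↦ t⁻¹) (Ioi 0) :=
    (hint.integrable_indicator measurableSet_Ioc).integrableOn
  constructor
  · exact h'.congr_fun (fun t ht ↦ (e t ht).symm) measurableSet_Ioi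
  · rw [setIntegral_congr_fun measurableSet_Ioi e, setIntegral_indicator measurableSet_Ioc,
      inter_eq_right.2 (Ioc_subset_Ioi_self.trans (Ioi_subset_Ioi hlam.le)),
      ← intervalIntegral.integral_of_le hlam1, integral_inv, one_div, Real.log_inv]
    rw [uIcc_of_le hlam1]; exact fun h ↦ by linarith [h.1]


/-- A single point is Lebesgue-null: `τ ≠ γ` for a.e. `τ`. [folklore] -/
private lemma ae_ne_real (γ : ℝ) : ∀ᵐ τ : ℝ, τ ≠ γ := by
  simp [ae_iff]

/-! ## The pairing of `k₁/s` with `1`: `∫ k₁(s)/s dτ = 2π ∫_λ^1 t^{ρ-1} p(-log t) dt → 2π (ρ-1)/ρ⁵` -/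

/-- For `t ≥ 0` real, `conj (t^w) = t^{conj w}`. [folklore] -/
private lemma conj_ofReal_cpow {t : ℝ} (ht : 0 ≤ t) (w : ℂ) : conj ((t : ℂ) ^ w) = (t : ℂ) ^ (conj w) := by
  have harg : (t : ℂ).arg ≠ π := by
    rw [arg_ofReal_of_nonneg ht]; exact Real.pi_ne_zero.symm
  have h := cpow_conj (t : ℂ) w harg
  rw [Complex.conj_ofReal] at h
  exact h.symm

/-- `p` is real on reals: `conj (p(x)) = p(x)`. [folklore] -/
lemma conj_pPolyC_ofReal (x : ℝ) : conj (pPolyC (x : ℂ)) = pPolyC (x : ℂ) := by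
  simp [pPolyC, map_div₀, map_sub, map_pow, Complex.conj_ofReal, map_ofNat]

/-- On the critical line, `conj ((1 - λ^{s-ρ})/(s-ρ)) = (λ^{ρ-s} - 1)/(s-ρ)` (`s - ρ` is purely
imaginary, `λ > 0`). [folklore] -/
lemma conj_mellin_gTrunc_kernel {lam : ℝ} (hlam : 0 ≤ lam) (γ τ : ℝ) :
    conj ((1 - (lam : ℂ) ^ (((1 / 2 : ℂ) + τ * I) - ((1 / 2 : ℂ) + γ * I))) /
        (((1 / 2 : ℂ) + τ * I) - ((1 / 2 : ℂ) + γ * I))) =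
      ((lam : ℂ) ^ (((1 / 2 : ℂ) + γ * I) - ((1 / 2 : ℂ) + τ * I)) - 1) /
        (((1 / 2 : ℂ) + τ * I) - ((1 / 2 : ℂ) + γ * I)) := by
  have e1 : conj (((1 / 2 : ℂ) + τ * I) - ((1 / 2 : ℂ) + γ * I)) =
      -(((1 / 2 : ℂ) + τ * I) - ((1 / 2 : ℂ) + γ * I)) := by
    apply Complex.ext
    · simp
    · simp; ring
  have e2 : conj (((1 / 2 : ℂ) + τ * I) - ((1 / 2 : ℂ) + γ * I)) =
      ((1 / 2 : ℂ) + γ * I) - ((1 / 2 : ℂ) + τ * I) := by rw [e1]; ring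
  rw [map_div₀, map_sub, map_one, conj_ofReal_cpow hlam, e2,
    show ((1 / 2 : ℂ) + γ * I) - ((1 / 2 : ℂ) + τ * I) = -(((1 / 2 : ℂ) + τ * I) - ((1 / 2 : ℂ) + γ * I))
      by ring, div_neg, ← neg_div, neg_sub]

/-- **The `k₁`-pairing in closed form** (Parseval with `g_λ` and `f`, Mellin inversion for `f`):
for `0 < λ ≤ 1`, `∫ k₁(s)/s dτ = 2π ∫_{(λ,1]} t^{ρ-1} p(-log t) dt`. [cite: Burnol2002, Thm. 5.3 (proof)] -/
theorem integral_burnolK1_div_eq (γ : ℝ) {lam : ℝ} (hlam : 0 < lam) (hlam1 : lam ≤ 1) :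
    ∫ τ : ℝ, burnolK1 ((1 / 2 : ℂ) + γ * I) lam ((1 / 2 : ℂ) + τ * I) / ((1 / 2 : ℂ) + τ * I) =
      2 * π * ∫ t in Ioc lam 1, (t : ℂ) ^ (((1 / 2 : ℂ) + γ * I) - 1) *
        pPolyC ((-Real.log t : ℝ) : ℂ) := by
  set ρ : ℂ := (1 / 2 : ℂ) + γ * I with hρ
  have hpair := integral_mul_conj_mellinInv (mellinConvergent_gTrunc γ hlam (1 / 2))
    integrable_mellin_fLog_line
  -- the left-hand side of Parseval: `∫_0^∞ g_λ · conj f`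
  have hL : ∫ t in Ioi (0 : ℝ), gTrunc γ lam t * conj (mellinInv (1 / 2) (mellin fLog) t) =
      ∫ t in Ioc lam 1, (t : ℂ) ^ (-ρ) * pPolyC ((-Real.log t : ℝ) : ℂ) := by
    have e : ∀ t ∈ Ioi (0 : ℝ), gTrunc γ lam t * conj (mellinInv (1 / 2) (mellin fLog) t) =
        (Ioc lam 1).indicator (fun t : ℝ ↦ (t : ℂ) ^ (-ρ) * pPolyC ((-Real.log t : ℝ) : ℂ)) t := by
      intro t ht
      rw [mellinInv_mellin_fLog ht]
      by_cases htm : t ∈ Ioc lam 1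
      · have h01 : t ∈ Ioc (0 : ℝ) 1 := ⟨ht, htm.2⟩
        rw [gTrunc, indicator_of_mem htm, indicator_of_mem htm, fLog, indicator_of_mem h01,
          conj_pPolyC_ofReal]
      · rw [gTrunc, indicator_of_notMem htm, indicator_of_notMem htm, zero_mul]
    rw [setIntegral_congr_fun measurableSet_Ioi e, setIntegral_indicator measurableSet_Ioc,
      inter_eq_right.2 (Ioc_subset_Ioi_self.trans (Ioi_subset_Ioi hlam.le))]
  -- the right-hand side of Parseval is the conjugate of our integrand
  have hR : ∀ᵐ τ : ℝ, mellin (gTrunc γ lam) ((1 / 2 : ℂ) + τ * I) *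
      conj (mellin fLog ((1 / 2 : ℂ) + τ * I)) =
      conj (burnolK1 ρ lam ((1 / 2 : ℂ) + τ * I) / ((1 / 2 : ℂ) + τ * I)) := by
    filter_upwards [ae_ne_real γ] with τ hτ
    have hs : (1 / 2 : ℂ) + τ * I ≠ ρ := fun h ↦ hτ (by
      have := congrArg Complex.im h; simpa [hρ] using this)
    have h1 : conj (mellin (gTrunc γ lam) ((1 / 2 : ℂ) + τ * I)) =
        ((lam : ℂ) ^ (ρ - ((1 / 2 : ℂ) + τ * I)) - 1) / (((1 / 2 : ℂ) + τ * I) - ρ) := by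
      rw [mellin_gTrunc γ hlam hlam1 hs, hρ, conj_mellin_gTrunc_kernel hlam.le γ τ]
    calc mellin (gTrunc γ lam) ((1 / 2 : ℂ) + τ * I) * conj (mellin fLog ((1 / 2 : ℂ) + τ * I))
        = conj (conj (mellin (gTrunc γ lam) ((1 / 2 : ℂ) + τ * I)) *
            mellin fLog ((1 / 2 : ℂ) + τ * I)) := by rw [map_mul, conj_conj]
      _ = conj (burnolK1 ρ lam ((1 / 2 : ℂ) + τ * I) / ((1 / 2 : ℂ) + τ * I)) := by
          rw [h1, mellin_fLog_line, burnolK1]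
          congr 1
          ring
  rw [hL, integral_congr_ae hR, integral_conj] at hpair
  -- solve for our integral
  have h2π : (2 * π : ℂ) ≠ 0 := by exact_mod_cast (by positivity : (2 * π : ℝ) ≠ 0)
  have key : conj (∫ τ : ℝ, burnolK1 ρ lam ((1 / 2 : ℂ) + τ * I) / ((1 / 2 : ℂ) + τ * I)) =
      2 * π * ∫ t in Ioc lam 1, (t : ℂ) ^ (-ρ) * pPolyC ((-Real.log t : ℝ) : ℂ) := by
    rw [hpair, ← mul_assoc, mul_one_div_cancel h2π, one_mul]
  have := congrArg conj key
  rw [conj_conj] at this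
  rw [this, map_mul, ← integral_conj]
  congr 1
  · simp [Complex.conj_ofReal, map_ofNat]
  · refine setIntegral_congr_fun measurableSet_Ioc fun t ht ↦ ?_
    rw [map_mul, conj_pPolyC_ofReal, conj_ofReal_cpow (hlam.le.trans ht.1.le)]
    congr 2
    rw [hρ]; apply Complex.ext <;> norm_num


/-- The integrand `t^{ρ-1} p(-log t)` is integrable on `(0,1]` and integrates to `𝓜f(ρ) = (ρ-1)/ρ⁵`.
[folklore] -/
theorem integral_Ioc_cpow_mul_pPolyC (γ : ℝ) :
    IntegrableOn (fun t : ℝ ↦ (t : ℂ) ^ (((1 / 2 : ℂ) + γ * I) - 1) * pPolyC ((-Real.log t : ℝ) : ℂ))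
      (Ioc 0 1) ∧
      ∫ t in Ioc (0 : ℝ) 1, (t : ℂ) ^ (((1 / 2 : ℂ) + γ * I) - 1) * pPolyC ((-Real.log t : ℝ) : ℂ) =
        (((1 / 2 : ℂ) + γ * I) - 1) / ((1 / 2 : ℂ) + γ * I) ^ 5 := by
  set ρ : ℂ := (1 / 2 : ℂ) + γ * I with hρ
  have hρre : 0 < ρ.re := by simp [hρ]
  have hconv := mellinConvergent_fLog hρre
  have e : ∀ t ∈ Ioi (0 : ℝ), (t : ℂ) ^ (ρ - 1) • fLog t =
      (Ioc (0 : ℝ) 1).indicator (fun t : ℝ ↦ (t : ℂ) ^ (ρ - 1) * pPolyC ((-Real.log t : ℝ) : ℂ)) t := by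
    intro t ht
    by_cases htm : t ∈ Ioc (0 : ℝ) 1
    · rw [fLog, indicator_of_mem htm, indicator_of_mem htm, smul_eq_mul]
    · rw [fLog, indicator_of_notMem htm, indicator_of_notMem htm, smul_zero]
  rw [MellinConvergent] at hconv
  have h1 : IntegrableOn ((Ioc (0 : ℝ) 1).indicator fun t : ℝ ↦
      (t : ℂ) ^ (ρ - 1) * pPolyC ((-Real.log t : ℝ) : ℂ)) (Ioi 0) :=
    hconv.congr_fun e measurableSet_Ioi
  rw [integrableOn_indicator_iff measurableSet_Ioc, IntegrableOn,
    inter_eq_left.2 Ioc_subset_Ioi_self] at h1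
  refine ⟨h1, ?_⟩
  have h2 := mellin_fLog hρre
  rw [mellin, setIntegral_congr_fun measurableSet_Ioi e, setIntegral_indicator measurableSet_Ioc,
    inter_eq_right.2 Ioc_subset_Ioi_self] at h2
  exact h2

/-- **Limit of the `k₁`-pairing** (Burnol, Thm. 5.3 for `k = 0`, Mellin side): as `λ → 0⁺`,
`∫ k₁(s)/s dτ → 2π (ρ-1)/ρ⁵` (`= 2π r(ρ)/ρ`). [cite: Burnol2002, Thm. 5.3] -/
theorem tendsto_integral_burnolK1_div (γ : ℝ) :
    Tendsto (fun lam : ℝ ↦ ∫ τ : ℝ,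
        burnolK1 ((1 / 2 : ℂ) + γ * I) lam ((1 / 2 : ℂ) + τ * I) / ((1 / 2 : ℂ) + τ * I))
      (𝓝[>] 0) (𝓝 (2 * π * ((((1 / 2 : ℂ) + γ * I) - 1) / ((1 / 2 : ℂ) + γ * I) ^ 5))) := by
  set ρ : ℂ := (1 / 2 : ℂ) + γ * I with hρ
  set F : ℝ → ℂ := fun t ↦ (t : ℂ) ^ (ρ - 1) * pPolyC ((-Real.log t : ℝ) : ℂ) with hF
  obtain ⟨hint, hval⟩ := integral_Ioc_cpow_mul_pPolyC γ
  -- continuity of `b ↦ ∫_1^b F` on `[0,1]` at `0`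
  have hII : IntervalIntegrable F volume 0 1 :=
    (intervalIntegrable_iff_integrableOn_Ioc_of_le zero_le_one).2 hint
  have hcont : ContinuousOn (fun b : ℝ ↦ ∫ t in (1 : ℝ)..b, F t) (uIcc 0 1) :=
    intervalIntegral.continuousOn_primitive_interval' hII (by simp)
  have h0mem : (0 : ℝ) ∈ uIcc (0 : ℝ) 1 := by simp
  have htend : Tendsto (fun b : ℝ ↦ ∫ t in (1 : ℝ)..b, F t) (𝓝[>] 0)
      (𝓝 (∫ t in (1 : ℝ)..0, F t)) := by
    refine ((hcont 0 h0mem).tendsto).mono_left (nhdsWithin_le_iff.2 ?_)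
    rw [uIcc_of_le zero_le_one]
    exact Icc_mem_nhdsGT one_pos
  have hlim : Tendsto (fun b : ℝ ↦ 2 * (π : ℂ) * -(∫ t in (1 : ℝ)..b, F t)) (𝓝[>] 0)
      (𝓝 (2 * π * (((ρ - 1) / ρ ^ 5)))) := by
    have := (htend.neg).const_mul (2 * (π : ℂ))
    rw [intervalIntegral.integral_symm, neg_neg, intervalIntegral.integral_of_le zero_le_one,
      hval] at this
    exact this
  refine hlim.congr' ?_
  filter_upwards [Ioo_mem_nhdsGT one_pos] with lam hlam
  rw [integral_burnolK1_div_eq γ hlam.1 hlam.2.le, ← intervalIntegral.integral_of_le hlam.2.le,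
    intervalIntegral.integral_symm lam 1, neg_neg]

/-! ## The pairing of `k₂/s` with `1` tends to zero (Riemann–Lebesgue) -/

/-- The `λ`-independent amplitude `G(τ) = (V(s)/V(ρ) - 1) r(s) / ((s-ρ) s)` of `k₂(s)/s`.
[folklore] -/
def k2Amp (γ τ : ℝ) : ℂ :=
  (burnolV ((1 / 2 : ℂ) + τ * I) / burnolV ((1 / 2 : ℂ) + γ * I) - 1) *
    burnolR ((1 / 2 : ℂ) + τ * I) / ((((1 / 2 : ℂ) + τ * I) - ((1 / 2 : ℂ) + γ * I)) *
      ((1 / 2 : ℂ) + τ * I))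

/-- `k₂(s)/s = G(τ) · λ^{ρ-s}`. [folklore] -/
theorem burnolK2_div_eq (γ lam τ : ℝ) :
    burnolK2 ((1 / 2 : ℂ) + γ * I) lam ((1 / 2 : ℂ) + τ * I) / ((1 / 2 : ℂ) + τ * I) =
      k2Amp γ τ * (lam : ℂ) ^ (((1 / 2 : ℂ) + γ * I) - ((1 / 2 : ℂ) + τ * I)) := by
  rw [burnolK2, k2Amp, div_div, div_mul_eq_mul_div, mul_right_comm]

/-- `G` is integrable. [folklore] -/
theorem integrable_k2Amp (γ : ℝ) : Integrable (k2Amp γ) := by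
  obtain ⟨D, hD0, hD⟩ := exists_norm_burnolV_div_sub_one_le γ
  have hm : Measurable (k2Amp γ) := by
    unfold k2Amp
    refine Measurable.div (Measurable.mul ?_ continuous_burnolR_line.measurable) (by fun_prop)
    exact (continuous_burnolV_line.measurable.div_const _).sub measurable_const
  refine (integrable_and_memLp_two_of_norm_le (C := D * 8 * 2) hm fun τ ↦ ?_).1
  rw [k2Amp, norm_div, norm_mul, norm_mul, norm_line_sub_line]
  by_cases hu : τ - γ = 0
  · simp [hu]; positivity
  have hu' : 0 < |τ - γ| := abs_pos.2 hu
  have hs : 1 / 2 ≤ ‖(1 / 2 : ℂ) + τ * I‖ := half_le_norm_line τ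
  rw [div_le_iff₀ (by positivity)]
  calc ‖burnolV ((1 / 2 : ℂ) + τ * I) / burnolV ((1 / 2 : ℂ) + γ * I) - 1‖ * ‖burnolR ((1 / 2 : ℂ) + τ * I)‖
      ≤ (D * |τ - γ|) * (8 * (1 + τ ^ 2)⁻¹) := by
        gcongr
        · exact hD τ
        · exact norm_burnolR_line_le_inv τ
    _ = D * 8 * 2 * (1 + τ ^ 2)⁻¹ * (|τ - γ| * (1 / 2)) := by ring
    _ ≤ D * 8 * 2 * (1 + τ ^ 2)⁻¹ * (|τ - γ| * ‖(1 / 2 : ℂ) + τ * I‖) := by gcongr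

/-- `∫ k₂(s)/s dτ` as a Fourier transform of `G`: `= e^{i γ log λ} · 𝓕G(log λ / (2π))`. [folklore] -/
theorem integral_burnolK2_div_eq (γ : ℝ) {lam : ℝ} (hlam : 0 < lam) :
    ∫ τ : ℝ, burnolK2 ((1 / 2 : ℂ) + γ * I) lam ((1 / 2 : ℂ) + τ * I) / ((1 / 2 : ℂ) + τ * I) =
      Complex.exp (((γ * Real.log lam : ℝ) : ℂ) * I) * 𝓕 (k2Amp γ) (Real.log lam / (2 * π)) := by
  rw [Real.fourier_real_eq_integral_exp_smul, ← integral_const_mul]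
  refine integral_congr_ae (Eventually.of_forall fun τ ↦ ?_)
  simp only
  rw [burnolK2_div_eq, cpow_rho_sub_line hlam, smul_eq_mul]
  rw [show Complex.exp (((γ * Real.log lam : ℝ) : ℂ) * I) *
      (Complex.exp (↑(-2 * π * τ * (Real.log lam / (2 * π))) * I) * k2Amp γ τ) =
      k2Amp γ τ * (Complex.exp (((γ * Real.log lam : ℝ) : ℂ) * I) *
        Complex.exp (↑(-2 * π * τ * (Real.log lam / (2 * π))) * I)) by ring, ← Complex.exp_add]
  congr 2
  have hπ : (π : ℂ) ≠ 0 := by exact_mod_cast Real.pi_ne_zero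
  push_cast
  field_simp
  ring

/-- **The `k₂`-pairing tends to zero** as `λ → 0⁺` (Riemann–Lebesgue lemma for `G ∈ L¹`).
[cite: Burnol2002, Thm. 5.3 (proof)] -/
theorem tendsto_integral_burnolK2_div (γ : ℝ) :
    Tendsto (fun lam : ℝ ↦ ∫ τ : ℝ,
        burnolK2 ((1 / 2 : ℂ) + γ * I) lam ((1 / 2 : ℂ) + τ * I) / ((1 / 2 : ℂ) + τ * I))
      (𝓝[>] 0) (𝓝 0) := by
  have hRL : Tendsto (𝓕 (k2Amp γ)) (cocompact ℝ) (𝓝 0) := Real.zero_at_infty_fourier (k2Amp γ)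
  have hlog : Tendsto (fun lam : ℝ ↦ Real.log lam / (2 * π)) (𝓝[>] 0) (cocompact ℝ) := by
    have h1 : Tendsto (fun lam : ℝ ↦ Real.log lam / (2 * π)) (𝓝[>] 0) atBot :=
      Real.tendsto_log_nhdsGT_zero.atBot_div_const (by positivity)
    exact h1.mono_right (by rw [cocompact_eq_atBot_atTop]; exact le_sup_left)
  have h2 := hRL.comp hlog
  rw [tendsto_zero_iff_norm_tendsto_zero] at h2 ⊢
  refine h2.congr' ?_
  filter_upwards [self_mem_nhdsWithin] with lam (hlam : 0 < lam)
  rw [integral_burnolK2_div_eq γ hlam, norm_mul, Complex.norm_exp_ofReal_mul_I, one_mul]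
  rfl

end BurnolVectors

end Literature.NumberTheory.LFunctions
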